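import Mathlib
import Literature.Analysis.FluidPDE.GalerkinFlow
import Literature.Analysis.ODE.LiouvilleInvariantMeasure
import HarnessLib

/-!
# Galerkin systems of the Navier–Stokes equations on `T^d`: measures satisfying the Liouville
  equation are invariant under the Galerkin semiflow

Trunk: FluidKinetic (`Literature/Analysis/FluidPDE`); theorems only. For the Fourier–Galerkin
system of order `S` of the forced Navier–Stokes equations with a steady force (autonomous quadratic
ODE `ċ = galerkinRHS S ν g c` on the finite-dimensional phase space `galerkinSubspace S`,
`NSGalerkinFourier`; global semiflow `galerkinCoeffFlow ν g`, `GalerkinFlow`), a finite Borel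
measure carried by a bounded part of the phase space which satisfies the stationary Liouville
equation `∫ Dψ(c)[galerkinRHS c] dμ(c) = 0` for all `C¹` compactly supported `ψ` is invariant
under the semiflow (`map_galerkinCoeffFlow_eq_self`). This is the direction "Liouville ⟹
invariant" of Foias–Manley–Rosa–Temam 2001, Ch. IV App. B.1, pp. 247–249 (the characterisation of
the invariant measures of the Galerkin approximations by the stationary Liouville equation, the
finite-dimensional prototype of their Def. 1.3 (1.30) of stationary statistical solutions), as an
instance of the abstract criterion `Literature.Analysis.ODE.map_flow_eq_self_of_forall_integral_fderiv_eq_zero`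
(`LiouvilleInvariantMeasure`); the only model-specific input is the smoothness of the (polynomial)
Galerkin field, `contDiff_galerkinRHS` (Constantin–Foias 1988, Ch. 8, p. 43).

## References

* C. Foias, O. Manley, R. Rosa, R. Temam, *Navier–Stokes Equations and Turbulence*, Cambridge
  Univ. Press (2001), Ch. IV §1.2 Def. 1.3 (1.30), §2 Thm. 2.2, App. B.1, pp. 247–249. [FMRT2001]
* P. Constantin, C. Foias, *Navier–Stokes Equations*, Univ. Chicago Press (1988), Ch. 8,
  (8.5)–(8.6), p. 43. [ConstantinFoias1988]
-/

noncomputable section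

open MeasureTheory Set Filter Topology Function Metric
open scoped NNReal

namespace Literature.Analysis.FluidPDE

open Literature.Analysis.FunctionSpaces.Torus

variable {d : Type*} [Fintype d] [DecidableEq d] {S : Finset (d → ℤ)}

/-! ### Smoothness of the Galerkin vector field -/

omit [DecidableEq d] in
/-- The coordinates `w ↦ w j` of `ℂ^d` are smooth over `ℝ` (continuous `ℝ`-linear). [folklore] -/
theorem contDiff_euclidean_proj_real (j : d) {n : WithTop ℕ∞} :
    ContDiff ℝ n fun w : EuclideanSpace ℂ d => w j :=
  ((EuclideanSpace.proj j : EuclideanSpace ℂ d →L[ℂ] ℂ).restrictScalars ℝ).contDiff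

omit [DecidableEq d] in
/-- The extension by zero `c ↦ c̄ l` is smooth in `c` for every frequency `l`. [folklore] -/
theorem contDiff_coeffExt_apply (l : d → ℤ) {n : WithTop ℕ∞} :
    ContDiff ℝ n fun c : ↥S → EuclideanSpace ℂ d => coeffExt S c l := by
  by_cases hl : l ∈ S
  · have : (fun c : ↥S → EuclideanSpace ℂ d => coeffExt S c l) = fun c => c ⟨l, hl⟩ :=
      funext fun c => coeffExt_of_mem c hl
    rw [this]
    exact contDiff_apply ℝ (EuclideanSpace ℂ d) (⟨l, hl⟩ : ↥S)
  · have : (fun c : ↥S → EuclideanSpace ℂ d => coeffExt S c l) = fun _ => 0 :=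
      funext fun c => coeffExt_of_not_mem c hl
    rw [this]
    exact contDiff_const

omit [DecidableEq d] in
/-- **The Galerkin vector field is smooth** (a quadratic polynomial map of the finite-dimensional
phase space: Stokes term linear, Leray symbol linear, convection term bilinear;
Constantin–Foias 1988, Ch. 8, p. 43: "a quadratic, constant coefficient ODE system"). [cite: ConstantinFoias1988, Ch. 8 (8.5)–(8.6), p. 43] -/
theorem contDiff_galerkinRHS (ν : ℝ) (g : ↥S → EuclideanSpace ℂ d) {n : WithTop ℕ∞} :
    ContDiff ℝ n (galerkinRHS S ν g) := by
  rw [contDiff_pi]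
  intro k
  simp only [galerkinRHS_apply, Torus.galerkinField_def]
  have hext : ∀ l, ContDiff ℝ n fun c : ↥S → EuclideanSpace ℂ d => coeffExt S c l :=
    fun l => contDiff_coeffExt_apply l
  have hconv : ContDiff ℝ n fun c : ↥S → EuclideanSpace ℂ d =>
      Torus.convectionCoeff S (coeffExt S c) (coeffExt S c) k := by
    simp only [Torus.convectionCoeff_def]
    refine ContDiff.sum fun l _ => ContDiff.sum fun m _ => ?_
    split_ifs
    · have hs : ContDiff ℝ n fun c : ↥S → EuclideanSpace ℂ d =>
          (2 * Real.pi * Complex.I * ∑ j, coeffExt S c l j * (m j : ℂ)) := by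
        refine contDiff_const.mul (ContDiff.sum fun j _ => ?_)
        exact ((contDiff_euclidean_proj_real j).comp (hext l)).mul contDiff_const
      exact hs.smul (hext m)
    · exact contDiff_const
  have hL : ContDiff ℝ n fun w : EuclideanSpace ℂ d => Torus.leraySym (k : d → ℤ) w := by
    have : (fun w : EuclideanSpace ℂ d => Torus.leraySym (k : d → ℤ) w) =
        fun w => ((Torus.leraySymₗ (k : d → ℤ)).toContinuousLinearMap.restrictScalars ℝ) w := by
      funext w; rfl
    rw [this]
    exact ContinuousLinearMap.contDiff _
  refine (ContDiff.neg ?_).add (hL.comp (contDiff_const.sub hconv))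
  have hs : ContDiff ℝ n fun _ : ↥S → EuclideanSpace ℂ d =>
      (((ν * (4 * Real.pi ^ 2 * freqNormSq (k : d → ℤ)) : ℝ) : ℂ)) := contDiff_const
  exact hs.smul (hext k)

/-! ### Invariance of measures satisfying the Liouville equation of a Galerkin system -/

/-- **A measure on the Galerkin phase space which satisfies the stationary Liouville equation is
invariant under the Galerkin semiflow** (Foias–Manley–Rosa–Temam 2001, Ch. IV App. B.1,
pp. 247–249: for the Galerkin approximations of the Navier–Stokes equations, a probability
measure `μ_m` is invariant for the semigroup `S_m(t)` iff `∫ (F_m(u), Φ'(u)) dμ_m = 0` for all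
test functionals; here the direction "Liouville ⟹ invariant"). For `ν ≥ 0`, a symmetric frequency
set `S`, real force coefficients `g`, and a finite Borel measure `μ` on the coefficient space
carried by a compact part `K` of the phase space `galerkinSubspace S` with
`∫ Dψ(c)[galerkinRHS c] dμ(c) = 0` for every `C¹` compactly supported `ψ`, the semiflow
`galerkinCoeffFlow ν g t` preserves `μ` for every `t ≥ 0`
(`Literature.Analysis.ODE.map_flow_eq_self_of_forall_integral_fderiv_eq_zero` applied to the
smooth Galerkin field and its global semiflow `GalerkinFlow`). [cite: FMRT2001, Ch. IV App. B.1 pp. 247–249] -/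
theorem map_galerkinCoeffFlow_eq_self {ν : ℝ} (hν : 0 ≤ ν) (hS : ∀ k ∈ S, -k ∈ S)
    {g : ↥S → EuclideanSpace ℂ d} (hg : IsRealCoeff g)
    {μ : Measure (↥S → EuclideanSpace ℂ d)} [IsFiniteMeasure μ] {K : Set (↥S → EuclideanSpace ℂ d)}
    (hK : IsCompact K) (hKV : K ⊆ (galerkinSubspace S : Set (↥S → EuclideanSpace ℂ d)))
    (hμ : μ Kᶜ = 0)
    (hL : ∀ ψ : (↥S → EuclideanSpace ℂ d) → ℝ, ContDiff ℝ 1 ψ → HasCompactSupport ψ →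
      ∫ c, fderiv ℝ ψ c (galerkinRHS S ν g c) ∂μ = 0) :
    ∀ t, 0 ≤ t → μ.map (galerkinCoeffFlow ν g t) = μ := by
  set V : Set (↥S → EuclideanSpace ℂ d) := ↑(galerkinSubspace S) with hV
  have hVc : IsClosed V := (galerkinSubspace S).closed_of_finiteDimensional
  have hsol : ∀ c ∈ V, IsGalerkinODESolution ν g c (fun t => galerkinCoeffFlow ν g t c) :=
    fun c hc => isGalerkinODESolution_galerkinCoeffFlow hν hS hg hc
  have hμV : μ.restrict V = μ := by
    refine Measure.restrict_eq_self_of_ae_mem ?_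
    rw [ae_iff]
    exact measure_mono_null (fun c (hc : c ∉ V) (h' : c ∈ K) => hc (hKV h')) hμ
  refine Literature.Analysis.ODE.map_flow_eq_self_of_forall_integral_fderiv_eq_zero
    (contDiff_galerkinRHS ν g) (V₀ := V) (fun c _ => galerkinCoeffFlow_zero c)
    (fun c hc => (hsol c hc).continuousOn)
    (fun c hc t ht => (hsol c hc).hasDerivWithinAt_Ici (T := t + 1) ⟨ht, by linarith⟩)
    (fun c hc s t hs ht => galerkinCoeffFlow_add hν hS hg hc hs ht)
    (fun t ht => ?_) hK hKV hμ hL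
  -- a.e. measurability of the time-`t` map: continuous on the closed phase space carrying `μ`
  have hcont : ContinuousOn (fun c => galerkinCoeffFlow ν g t c) V :=
    (continuousOn_galerkinCoeffFlow hν hS hg).comp (continuousOn_const.prodMk continuousOn_id)
      fun c hc => ⟨mem_Ici.2 ht, hc⟩
  rw [← hμV]
  exact hcont.aemeasurable hVc.measurableSet

end Literature.Analysis.FluidPDE
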